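import Literature.Computability.AlgebraicComplexity.BI17FormsGenericNonNormalityProofs
import Literature.Computability.AlgebraicComplexity.BI17InvariantsRectangularHighestWeight
import HarnessLib

/-!
# Bürgisser–Ikenmeyer 2017, Cor. 3.17 (2) for binary quintics and binary sextics — PROVED:
# almost every binary form of degree `5` or `6` has a non-normal `GL_2`-orbit closure

P. Bürgisser, C. Ikenmeyer, *Fundamental invariants of orbit closures*, J. Algebra **477** (2017)
390–434 = arXiv:1511.02927 [BurgisserIkenmeyer2017], Cor. 3.17 (2) (TeX L1170): "Suppose that
`a'(D,m) = 1` and let `w ∈ Sym^D ℂ^m` be generic. Then `\overline{Gw}` is not normal if `D` is odd, or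
if `D` is even and `gcd(D,m) > 1`." For binary forms (`m = 2`) every `D ≥ 5` qualifies
(`a'(D,2) = 1` by App. Prop. 7.4 (3), the tree's `BI2017_prop_A_4_part3`; `D` odd, or `gcd(D,2) = 2`);
the printed proof needs generic polystability (Prop. 2.10, open in the tree beyond `(4,2)`).
THEOREMS ONLY (cell `val-lit`, row BI2017-A); no definition, no named fact; the named facts
`BI2017_cor_3_17`, `BI2017_prop_A_4` of `BI17FundamentalInvariantForms.lean` are not restated.

## Method (ours): two invariant degrees, by kernel plethysm values

By this seat's reduction `isZariskiGeneric_not_isIntegrallyClosed_of_invariants`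
(`BI17FormsGenericNonNormalityProofs.lean`: nonzero `SL_m`-invariants of degrees `(m/g)t`,
`(m/g)(t+1)` ⇒ generic non-normality, no Prop. 2.10) and val-lit-p4's
`mem_genericDegreeMonoid_iff_plethysmCoeff_ne_zero` (`d ∈ E(D,m) ↔ a_{((Dd/m)^m)}(d[D]) ≠ 0`), each
format costs two plethysm coefficients of TWO-ROW rectangles, evaluated in the kernel from
Dörfler–Ikenmeyer–Panova's formula (4.4) (`DIP20_eq_4_4_holds`, here with `ℓ = 2`: the sum over
`𝔖_2` of two monomial counts `c_ν(d,D)`, `dipMonomialCount_eq_L`, `decide +kernel`; for binary forms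
these are the classical Cayley–Sylvester numbers `p(d, D, Dd/2) − p(d, D, Dd/2 − 1)`).

| `D` | `g` | degrees | kernel values | classical reading |
|---|---|---|---|---|
| `5` | `1` | `16, 18` (`t = 8`) | `a_{(40,40)}(16[5]) = 4`, `a_{(45,45)}(18[5]) = 1` | `I_4^4, I_4^2 I_8, I_8^2, I_4 I_{12}`; the skew invariant `I_{18}` |
| `6` | `2` | `14, 15` (`t = 14`) | `a_{(42,42)}(14[6]) = 10`, `a_{(45,45)}(15[6]) = 1` | monomials in `I_2, I_4, I_6, I_{10}`; the skew invariant `I_{15}` |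

Results: `isZariskiGeneric_not_isIntegrallyClosed_five_two`, `…_six_two` (Cor. 3.17 (2) at `(5,2)`,
`(6,2)`, UNCONDITIONAL), the generic periods `a(5,2) = 5`, `a(6,2) = 3` with `a' = 1`
(`isZariskiGeneric_period_five_two`, `…_six_two`; the value `a' = 1` is also t06's
`BI2017_prop_A_4_part3`), and the clause instances `BI2017_cor_3_17_part2_five_two / _six_two`.
(`(4,2)` is the tree's `BI2017_cor_3_17_2_four_two`; `(8,2)`, `(12,2)`, … are instances of
`isZariskiGeneric_not_isIntegrallyClosed_of_mul_even`.)

Honest framing: classical invariant theory of binary forms as typed-literature bookkeeping (cell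
`val-lit`, LADDER-VALIANT V3); nothing here bears on VP versus VNP.

## References

* [BurgisserIkenmeyer2017] Cor. 3.17 (L1170), App. Prop. 7.4 (L2943), Def. 3.6.
* [DorflerIkenmeyerPanova2020] eqs. (4.3)–(4.4) (arXiv p. 9).
-/

namespace Literature.Computability.AlgebraicComplexity

open MvPolynomial
open _root_.Literature.NumberTheory.DiophantineGeometry

/-- A weakly decreasing pair is antitone. [folklore] -/
private theorem antitone_fin_two {a b : ℕ} (h : b ≤ a) : Antitone (![a, b] : Fin 2 → ℕ) := by
  intro i j hij
  fin_cases i <;> fin_cases j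
  · exact le_rfl
  · simpa using h
  · simp at hij
  · exact le_rfl

/-! ### Kernel plethysm values (two-row rectangles) -/

section KernelValues

set_option maxHeartbeats 2000000 in -- two kernel monomial counts (DIP (4.3))
/-- **`a_{(40,40)}(16[5]) = 4`** (binary quintics: invariants of degree `16`). (4.4) over `𝔖_2`,
`decide +kernel`. [cite: DorflerIkenmeyerPanova2020, eqs. (4.3)–(4.4)] -/
theorem plethysmCoeff_five_rowDual_forty_forty : plethysmCoeff ℂ (Fin 2) 5 (rowDual ![40, 40]) = 4 := by
  have h : (plethysmCoeff ℂ (Fin 2) 5 (rowDual ![40, 40]) : ℤ) = 4 := by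
    rw [DIP20_eq_4_4_holds 2 5 16 ![40, 40] (by norm_num) (antitone_fin_two le_rfl)
      (by rw [Fin.sum_univ_two]; rfl)]
    simp only [dipMonomialCount_eq_L]
    decide +kernel
  exact_mod_cast h

set_option maxHeartbeats 2000000 in -- two kernel monomial counts (DIP (4.3))
/-- **`a_{(45,45)}(18[5]) = 1`** (binary quintics: the skew invariant of degree `18`).
[cite: DorflerIkenmeyerPanova2020, eqs. (4.3)–(4.4)] -/
theorem plethysmCoeff_five_rowDual_fortyfive_fortyfive :
    plethysmCoeff ℂ (Fin 2) 5 (rowDual ![45, 45]) = 1 := by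
  have h : (plethysmCoeff ℂ (Fin 2) 5 (rowDual ![45, 45]) : ℤ) = 1 := by
    rw [DIP20_eq_4_4_holds 2 5 18 ![45, 45] (by norm_num) (antitone_fin_two le_rfl)
      (by rw [Fin.sum_univ_two]; rfl)]
    simp only [dipMonomialCount_eq_L]
    decide +kernel
  exact_mod_cast h

set_option maxHeartbeats 2000000 in -- two kernel monomial counts (DIP (4.3))
/-- **`a_{(42,42)}(14[6]) = 10`** (binary sextics: invariants of degree `14`).
[cite: DorflerIkenmeyerPanova2020, eqs. (4.3)–(4.4)] -/
theorem plethysmCoeff_six_rowDual_fortytwo_fortytwo :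
    plethysmCoeff ℂ (Fin 2) 6 (rowDual ![42, 42]) = 10 := by
  have h : (plethysmCoeff ℂ (Fin 2) 6 (rowDual ![42, 42]) : ℤ) = 10 := by
    rw [DIP20_eq_4_4_holds 2 6 14 ![42, 42] (by norm_num) (antitone_fin_two le_rfl)
      (by rw [Fin.sum_univ_two]; rfl)]
    simp only [dipMonomialCount_eq_L]
    decide +kernel
  exact_mod_cast h

set_option maxHeartbeats 2000000 in -- two kernel monomial counts (DIP (4.3))
/-- **`a_{(45,45)}(15[6]) = 1`** (binary sextics: the skew invariant of degree `15`).
[cite: DorflerIkenmeyerPanova2020, eqs. (4.3)–(4.4)] -/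
theorem plethysmCoeff_six_rowDual_fortyfive_fortyfive :
    plethysmCoeff ℂ (Fin 2) 6 (rowDual ![45, 45]) = 1 := by
  have h : (plethysmCoeff ℂ (Fin 2) 6 (rowDual ![45, 45]) : ℤ) = 1 := by
    rw [DIP20_eq_4_4_holds 2 6 15 ![45, 45] (by norm_num) (antitone_fin_two le_rfl)
      (by rw [Fin.sum_univ_two]; rfl)]
    simp only [dipMonomialCount_eq_L]
    decide +kernel
  exact_mod_cast h

end KernelValues

/-! ### Degrees in `E(5,2)` and `E(6,2)` -/

section Degrees

/-- `16 ∈ E(5,2)`. [cite: BurgisserIkenmeyer2017, Def. 3.6] -/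
theorem sixteen_mem_genericDegreeMonoid_five_two : 16 ∈ genericDegreeMonoid (Fin 2) ℂ 5 := by
  rw [mem_genericDegreeMonoid_iff_plethysmCoeff_ne_zero (by norm_num) (by norm_num) ⟨40, by norm_num⟩]
  have h : (fun _ : Fin 2 => -((5 * 16 / 2 : ℕ) : ℤ)) = rowDual ![40, 40] := by
    funext i
    fin_cases i <;> simp [rowDual, Weight.dual]
  rw [h, plethysmCoeff_five_rowDual_forty_forty]
  norm_num

/-- `18 ∈ E(5,2)`. [cite: BurgisserIkenmeyer2017, Def. 3.6] -/
theorem eighteen_mem_genericDegreeMonoid_five_two : 18 ∈ genericDegreeMonoid (Fin 2) ℂ 5 := by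
  rw [mem_genericDegreeMonoid_iff_plethysmCoeff_ne_zero (by norm_num) (by norm_num) ⟨45, by norm_num⟩]
  have h : (fun _ : Fin 2 => -((5 * 18 / 2 : ℕ) : ℤ)) = rowDual ![45, 45] := by
    funext i
    fin_cases i <;> simp [rowDual, Weight.dual]
  rw [h, plethysmCoeff_five_rowDual_fortyfive_fortyfive]
  exact one_ne_zero

/-- `14 ∈ E(6,2)`. [cite: BurgisserIkenmeyer2017, Def. 3.6] -/
theorem fourteen_mem_genericDegreeMonoid_six_two : 14 ∈ genericDegreeMonoid (Fin 2) ℂ 6 := by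
  rw [mem_genericDegreeMonoid_iff_plethysmCoeff_ne_zero (by norm_num) (by norm_num) ⟨42, by norm_num⟩]
  have h : (fun _ : Fin 2 => -((6 * 14 / 2 : ℕ) : ℤ)) = rowDual ![42, 42] := by
    funext i
    fin_cases i <;> simp [rowDual, Weight.dual]
  rw [h, plethysmCoeff_six_rowDual_fortytwo_fortytwo]
  norm_num

/-- `15 ∈ E(6,2)`. [cite: BurgisserIkenmeyer2017, Def. 3.6] -/
theorem fifteen_mem_genericDegreeMonoid_six_two : 15 ∈ genericDegreeMonoid (Fin 2) ℂ 6 := by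
  rw [mem_genericDegreeMonoid_iff_plethysmCoeff_ne_zero (by norm_num) (by norm_num) ⟨45, by norm_num⟩]
  have h : (fun _ : Fin 2 => -((6 * 15 / 2 : ℕ) : ℤ)) = rowDual ![45, 45] := by
    funext i
    fin_cases i <;> simp [rowDual, Weight.dual]
  rw [h, plethysmCoeff_six_rowDual_fortyfive_fortyfive]
  exact one_ne_zero

end Degrees

/-! ### Cor. 3.17 (2) and the generic periods for binary quintics and sextics -/

section Instances

/-- **Cor. 3.17 (2) at `(5,2)`, UNCONDITIONAL: almost all binary quintics have a non-normal
`GL_2`-orbit closure** (`D = 5` odd; invariant degrees `16 = 2·8`, `18 = 2·9`).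
[cite: BurgisserIkenmeyer2017, Cor. 3.17 (2)] -/
theorem isZariskiGeneric_not_isIntegrallyClosed_five_two :
    IsZariskiGeneric 5 fun f : MvPolynomial (Fin 2) ℂ => ¬ IsIntegrallyClosed (OrbitCoordRing f 5) := by
  obtain ⟨F₁, hF₁h, hF₁i, hF₁0⟩ := sixteen_mem_genericDegreeMonoid_five_two
  obtain ⟨F₂, hF₂h, hF₂i, hF₂0⟩ := eighteen_mem_genericDegreeMonoid_five_two
  exact isZariskiGeneric_not_isIntegrallyClosed_of_invariants (D := 5) (m := 2) (t := 8) (by norm_num)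
    le_rfl (F₁ := F₁) (F₂ := F₂) (by simpa using hF₁h) hF₁i hF₁0 (by simpa using hF₂h) hF₂i hF₂0
    (Or.inl (by decide))

/-- **`a(5,2) = 5`, `a'(5,2) = 1`** generically (App. Prop. 7.4 (3) gives the trivial stabilizer; here
from the invariant degrees `16, 18`). [cite: BurgisserIkenmeyer2017, §7 (Appendix) Prop. 7.4] -/
theorem isZariskiGeneric_period_five_two :
    IsZariskiGeneric 5 (fun f : MvPolynomial (Fin 2) ℂ =>
      stabilizerPeriod f = 5 ∧ reducedStabilizerPeriod 5 f = 1) := by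
  obtain ⟨F₁, hF₁h, hF₁i, hF₁0⟩ := sixteen_mem_genericDegreeMonoid_five_two
  obtain ⟨F₂, hF₂h, hF₂i, hF₂0⟩ := eighteen_mem_genericDegreeMonoid_five_two
  have h := isZariskiGeneric_period_of_invariants (D := 5) (m := 2) (t := 8) (by norm_num) (by norm_num)
    (F₁ := F₁) (F₂ := F₂) (by simpa using hF₁h) hF₁i hF₁0 (by simpa using hF₂h) hF₂i hF₂0
  exact h.mono fun f _ hf => ⟨by simpa using hf.1, hf.2⟩

/-- **Cor. 3.17 (2) at `(6,2)`, UNCONDITIONAL: almost all binary sextics have a non-normal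
`GL_2`-orbit closure** (`gcd(6,2) = 2 > 1`; invariant degrees `14, 15`).
[cite: BurgisserIkenmeyer2017, Cor. 3.17 (2)] -/
theorem isZariskiGeneric_not_isIntegrallyClosed_six_two :
    IsZariskiGeneric 6 fun f : MvPolynomial (Fin 2) ℂ => ¬ IsIntegrallyClosed (OrbitCoordRing f 6) := by
  obtain ⟨F₁, hF₁h, hF₁i, hF₁0⟩ := fourteen_mem_genericDegreeMonoid_six_two
  obtain ⟨F₂, hF₂h, hF₂i, hF₂0⟩ := fifteen_mem_genericDegreeMonoid_six_two
  exact isZariskiGeneric_not_isIntegrallyClosed_of_invariants (D := 6) (m := 2) (t := 14) (by norm_num)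
    le_rfl (F₁ := F₁) (F₂ := F₂) (by simpa using hF₁h) hF₁i hF₁0 (by simpa using hF₂h) hF₂i hF₂0
    (Or.inr (by decide))

/-- **`a(6,2) = 3`, `a'(6,2) = 1`** generically (invariant degrees `14, 15`).
[cite: BurgisserIkenmeyer2017, §7 (Appendix) Prop. 7.4] -/
theorem isZariskiGeneric_period_six_two :
    IsZariskiGeneric 6 (fun f : MvPolynomial (Fin 2) ℂ =>
      stabilizerPeriod f = 3 ∧ reducedStabilizerPeriod 6 f = 1) := by
  obtain ⟨F₁, hF₁h, hF₁i, hF₁0⟩ := fourteen_mem_genericDegreeMonoid_six_two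
  obtain ⟨F₂, hF₂h, hF₂i, hF₂0⟩ := fifteen_mem_genericDegreeMonoid_six_two
  have h := isZariskiGeneric_period_of_invariants (D := 6) (m := 2) (t := 14) (by norm_num)
    (by norm_num) (F₁ := F₁) (F₂ := F₂) (by simpa using hF₁h) hF₁i hF₁0 (by simpa using hF₂h) hF₂i
    hF₂0
  exact h.mono fun f _ hf => ⟨by simpa using hf.1, hf.2⟩

/-- Cor. 3.17 (2)'s clause (`BI2017_cor_3_17`'s second conjunct) at `(D,m) = (5,2)`, PROVED.
[cite: BurgisserIkenmeyer2017, Cor. 3.17 (2)] -/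
theorem BI2017_cor_3_17_part2_five_two : 2 ≤ 5 → 2 ≤ 2 →
    IsZariskiGeneric 5 (fun f : MvPolynomial (Fin 2) ℂ => reducedStabilizerPeriod 5 f = 1) →
    (Odd 5 ∨ 1 < Nat.gcd 5 2) →
    IsZariskiGeneric 5 fun f : MvPolynomial (Fin 2) ℂ => ¬ IsIntegrallyClosed (OrbitCoordRing f 5) :=
  fun _ _ _ _ => isZariskiGeneric_not_isIntegrallyClosed_five_two

/-- Cor. 3.17 (2)'s clause at `(D,m) = (6,2)`, PROVED. [cite: BurgisserIkenmeyer2017, Cor. 3.17 (2)] -/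
theorem BI2017_cor_3_17_part2_six_two : 2 ≤ 6 → 2 ≤ 2 →
    IsZariskiGeneric 6 (fun f : MvPolynomial (Fin 2) ℂ => reducedStabilizerPeriod 6 f = 1) →
    (Odd 6 ∨ 1 < Nat.gcd 6 2) →
    IsZariskiGeneric 6 fun f : MvPolynomial (Fin 2) ℂ => ¬ IsIntegrallyClosed (OrbitCoordRing f 6) :=
  fun _ _ _ _ => isZariskiGeneric_not_isIntegrallyClosed_six_two

end Instances

end Literature.Computability.AlgebraicComplexity
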